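import Summits.QuantumFields.BalabanUV.Beta.D1BFx.LocalVertexByParts

/-!
# `BalabanUV.Beta.D1BFx.LocalVertexByPartsSum` — road «BF-x» for binder row D1, slot (K), END row `hGrp gN`, «GN-T12 ∕ FRAME-Σ» (part 2 of 2):
# THE SUMMED FRAMES — `|Σ'_w W(w)·vtx (b+w) L F G| ≤ K·Σ'_w (|W|·Φ₀Γ₁ + W₁·Φ₀Γ₀)` for any list of grading 1 (column end good; row end good by
# the transpose `trStn`), and the instances `|Σ'_w W(w)·biBubble A (SbT κ (b+w)) B (φ ⊗ ψ)| ≤ K·Σ'_w (…)` for the six `SbT` pieces of T₁ ∕ T₂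

HONEST DEPENDENCY (cell records, verbatim): «continuum YM on T⁴ ⇐ BetaPertH ∧ nine spine estimates (0/9 proved); BetaPertH ⇐ (D1) ∧ (D4) ∧
CAP+tail; G-an2-4 gates asym, D1 and NE2/3/4.»  HONEST FRAMING (cell contract, verbatim): «discharging `BetaPertH` makes Bałaban's UV stability
UNCONDITIONAL — a real constructive-QFT result; it is NOT the continuum limit and NOT the Clay problem.»  THIS MODULE DISCHARGES NOTHING of the
wall: [folklore] `tsum` algebra (shift by `Equiv.addRight`, `Summable.tsum_add∕tsum_sub`, `Summable.of_norm_bounded`, `tsum_of_norm_bounded`) over part 1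
`LocalVertexByParts` (`colGood_of_terms`, `abs_eval_le_colStep`, `abs_eval_le_sup`) and the owner's «GN-T12 ∕ FRAME» (`LocalVertexForm`: `vtx`, `VTerm`,
`exists_vterms_of_graded`, `biBubble_realK_outer`, list-sum helpers), leaf-03-g4's `CrossERestLists.graded_trStn`, `WilsonStencilRealised.trStn`,
leaf-03-g12's `GluonBubbleTails.SbT_eq_realK` ∕ `graded_SbT_list`.  No `def`, no `def … : Prop`, nothing cited, no hypothesis is a printed statement,
0 sorry.  Asserts NO bound on any table of the road: the window majorants `Φ₀ Γ₀ Γ₁` (resp. `Φ₀ Φ₁ Γ₀`), the weight `W` and its step modulus `W₁`,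
and three summabilities are HYPOTHESES.  Root-level binders hW ∕ hR-sockets ∕ hSX-socket ∕ D1Tel ∕ D1Rep — 0 discharged; (K) NOT closed; NOT D1,
NOT `BetaPertH`, NOT continuum, NOT Clay.

ABSOLUTE RULE (cell charter, verbatim): «No internally-minted statement may enter as a cited fact. Every hypothesis is either kernel-proved in
this package or a verbatim quotation of a PUBLISHED theorem with page reference. The manuscript(s) under audit are NOT citable for their own
disputed steps — they are the thing under adjudication; programme-internal (2001/route/tribunal) claims are never citable.»

WHY (FINDING F-d1leaf03g13-1, journal 2026-08-21 ≈12:08Z; part 1's header): summation by parts in the (1.22) variable moves the list's step OFF the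
bad end; the bad end then enters ONLY through its window values `Φ₀` (resp. `Γ₀`), at the price of the weight's step modulus `W₁` (`≤ 3·nrm(w)` for
`w_μw_ν`) on the undifferentiated product — the frame on which the K-piece of T₁ (`SbT ⊗ dip`, weight `cgh·n²`) is flat with d1-class letters.
* §4 [folklore] `mul_list_sum`, `summable_list_sum`, `abs_tsum_list_sum_le`, `summable_and_abs_tsum_le_of_le`, **`tsum_shift_sub`**
  (`Σ' W·(E(·+a) − E) = Σ' (W(·−a) − W)·E`), `summable_shift`, **`exists_tsum_bound_colGood`**, `vtx_trStn`, **`exists_tsum_bound_rowGood`**.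
* §5 [folklore] **`exists_SbT_outer_tsum_bound_colGood`**, **`exists_SbT_outer_tsum_bound_rowGood`**.
NOT HERE (honest): any letter, any weight, any cell; the `fullSum` reading (consumer files, `WindowIdentification.fullSum_eq_tsum_sub`).
Unit `b2b-balaban-beta-d1-formalise-leaf-03` (gen 13), D1 formalisation swarm, road «BF-x»; `LEAVES-BFx.md` row (N) «GN-K» (frame, part 2 of 2).
-/

noncomputable section

namespace Summit.QuantumFields.BalabanUV.Beta.D1BFx.LocalVertexByParts

open Finset
open scoped BigOperators
open Literature.MathematicalPhysics.QuantumFieldTheory.Balaban1983to89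
open Literature.MathematicalPhysics.QuantumFieldTheory.Balaban1983to89.Beta
open ExpKernelCalculus (Site MKer)
open DyadicShell (Pt supNorm)
open BubbleTransfer (unitVec)
open GradedBubbles (LP Stn rowSh colSh smulS rowDiff colDiff Graded IsStep)
open Summit.QuantumFields.BalabanUV.Beta.D1BFx.StencilRealisation (realK)
open Summit.QuantumFields.BalabanUV.Beta.D1BFx.WilsonStencilRealised (trStn reixStn ιU)
open Summit.QuantumFields.BalabanUV.Beta.D1BFx.CrossERestLists (graded_trStn)
open Summit.QuantumFields.BalabanUV.Beta.D1BFx.SectorRecut (SbT)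
open Summit.QuantumFields.BalabanUV.Beta.D1BFx.GluonBubbleTails (SbT_eq_realK graded_SbT_list)
open Summit.QuantumFields.BalabanUV.Beta.D1BFx.PackedKernelSplit (biBubble)
open Summit.QuantumFields.BalabanUV.Beta.D1BFx.RankOneBubble (outer applyK applyKT)
open Summit.QuantumFields.BalabanUV.Beta.D1BFx.LocalVertexForm (shiftB fdiffB iterΔ vtx VTerm shiftB_apply fdiffB_apply iterΔ_nil iterΔ_cons vtx_nil
  vtx_cons exists_vterms_of_graded biBubble_realK_outer supNorm_add_step_sub_le abs_iterΔ_cons_le abs_sum_sum_mul_mul_le list_abs_sum_le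
  list_sum_le_sum list_sum_nonneg list_le_sum_nat)

variable {I : Type*} [Fintype I]

/-! ## §4 `tsum` bookkeeping and the summed frame of a list of grading 1 -/

section Sums

omit [Fintype I] in
/-- [folklore] A scalar times a list sum. -/
theorem mul_list_sum {α : Type*} (l : List α) (c : ℝ) (f : α → ℝ) : c * (l.map f).sum = (l.map fun t => c * f t).sum := by
  rw [List.sum_map_mul_left]

omit [Fintype I] in
/-- [folklore] **SUMMABILITY AND `tsum` OF A FINITE LIST OF SUMMABLE FAMILIES.** -/
theorem summable_list_sum {α : Type*} (l : List α) (f : α → Pt → ℝ) (hf : ∀ t ∈ l, Summable (f t)) :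
    Summable (fun w => (l.map fun t => f t w).sum) ∧ ∑' w, (l.map fun t => f t w).sum = (l.map fun t => ∑' w, f t w).sum := by
  induction l with
  | nil => simp
  | cons t l ih =>
    obtain ⟨hs, he⟩ := ih fun t' ht' => hf t' (List.mem_cons_of_mem _ ht')
    have ht := hf t List.mem_cons_self
    simp only [List.map_cons, List.sum_cons]
    exact ⟨ht.add hs, by rw [ht.tsum_add hs, he]⟩

omit [Fintype I] in
/-- [folklore] **LIST ASSEMBLY OF `tsum` BOUNDS**: termwise `Summable (f t)` and `|Σ' f t| ≤ κ t · S` give the list sum summable with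
`|Σ' Σ_l f t| ≤ (Σ_l κ t)·S`. -/
theorem abs_tsum_list_sum_le {α : Type*} (l : List α) (f : α → Pt → ℝ) (κ : α → ℝ) (S : ℝ)
    (hf : ∀ t ∈ l, Summable (f t) ∧ |∑' w, f t w| ≤ κ t * S) :
    Summable (fun w => (l.map fun t => f t w).sum) ∧ |∑' w, (l.map fun t => f t w).sum| ≤ (l.map κ).sum * S := by
  obtain ⟨hs, he⟩ := summable_list_sum l f fun t ht => (hf t ht).1
  refine ⟨hs, ?_⟩
  rw [he, ← List.sum_map_mul_right]
  exact (list_abs_sum_le l _).trans (list_sum_le_sum l fun t ht => (hf t ht).2)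

omit [Fintype I] in
/-- [folklore] **DOMINATED `tsum`**: `|f w| ≤ c·g w` with `g` summable ⇒ `f` summable and `|Σ' f| ≤ c·Σ' g`. -/
theorem summable_and_abs_tsum_le_of_le {f g : Pt → ℝ} {c : ℝ} (hg : Summable g) (h : ∀ w, |f w| ≤ c * g w) :
    Summable f ∧ |∑' w, f w| ≤ c * ∑' w, g w := by
  have hs : Summable f := Summable.of_norm_bounded (hg.mul_left c) fun w => by rw [Real.norm_eq_abs]; exact h w
  refine ⟨hs, ?_⟩
  have h1 : ‖∑' w, f w‖ ≤ ∑' w, c * g w := tsum_of_norm_bounded (hg.mul_left c).hasSum fun w => by rw [Real.norm_eq_abs]; exact h w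
  rw [Real.norm_eq_abs, tsum_mul_left] at h1
  exact h1

omit [Fintype I] in
/-- [folklore] **THE BY-PARTS SHIFT UNDER `tsum`**: `Σ'_w W(w)·(E(w+a) − E(w)) = Σ'_w (W(w−a) − W(w))·E(w)` (both products summable). -/
theorem tsum_shift_sub (W E : Pt → ℝ) (a : Pt) (h1 : Summable fun w => W w * E (w + a)) (h2 : Summable fun w => W w * E w) :
    (Summable fun w => W w * (E (w + a) - E w)) ∧ ∑' w, W w * (E (w + a) - E w) = ∑' w, (W (w - a) - W w) * E w := by
  have h3 : Summable fun w : Pt => W (w - a) * E w :=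
    (Equiv.addRight a).summable_iff.mp (h1.congr fun w => by
      show W w * E (w + a) = W (w + a - a) * E (w + a)
      rw [add_sub_cancel_right])
  have h4 : ∑' w : Pt, W w * E (w + a) = ∑' w : Pt, W (w - a) * E w := by
    rw [← (Equiv.addRight a).tsum_eq (fun w : Pt => W (w - a) * E w)]
    exact tsum_congr fun w => by simp only [Equiv.coe_addRight, add_sub_cancel_right]
  refine ⟨(h1.sub h2).congr fun w => by ring, ?_⟩
  calc ∑' w, W w * (E (w + a) - E w) = ∑' w, (W w * E (w + a) - W w * E w) := tsum_congr fun w => by ring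
    _ = ∑' w, W w * E (w + a) - ∑' w, W w * E w := h1.tsum_sub h2
    _ = ∑' w, W (w - a) * E w - ∑' w, W w * E w := by rw [h4]
    _ = ∑' w, (W (w - a) * E w - W w * E w) := (h3.tsum_sub h2).symm
    _ = _ := tsum_congr fun w => by ring

omit [Fintype I] in
/-- [folklore] A shifted summable family is summable. -/
theorem summable_shift {g : Pt → ℝ} (hg : Summable g) (a : Pt) : Summable fun w => g (w + a) :=
  (Equiv.addRight a).summable_iff.mpr hg

/-- [folklore] **THE SUMMED FRAME OF A LIST OF GRADING 1, COLUMN END GOOD.**  There are `K ≥ 0` and a window radius `R` (depending only on the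
list) such that for every base point `b`, all end functions `F` (row, BAD) and `G` (column, GOOD), every weight `W` with step modulus `W₁`
(`|W(w−a) − W(w)| ≤ W₁(w)` for unit steps `a`), and all window majorants around `b + w` — values `|F| ≤ Φ₀(w)`, values `|G| ≤ Γ₀(w)`, forward unit
differences `|∇G| ≤ Γ₁(w)` on `‖q − (b+w)‖∞ ≤ R` — with `|W|·Φ₀Γ₁`, `|W|·Φ₀Γ₀`, `W₁·Φ₀Γ₀` summable:
`Σ'_w W(w)·vtx (b+w) L F G` converges absolutely and `|Σ'_w W(w)·vtx (b+w) L F G| ≤ K·Σ'_w (|W(w)|·Φ₀(w)Γ₁(w) + W₁(w)·Φ₀(w)Γ₀(w))`.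
No unit difference of the bad end `F` is ever used. -/
theorem exists_tsum_bound_colGood {L : Stn I} (h : Graded 1 L) :
    ∃ (K : ℝ) (R : ℕ), 0 ≤ K ∧ ∀ (b : Pt) (F G : Pt → I → ℝ) (W Φ₀ Γ₀ Γ₁ W₁ : Pt → ℝ),
      (∀ w, 0 ≤ Φ₀ w) → (∀ w, 0 ≤ Γ₀ w) → (∀ w, 0 ≤ Γ₁ w) →
      (∀ (w q : Pt) (g : I), supNorm (q - (b + w)) ≤ R → |F q g| ≤ Φ₀ w) →
      (∀ (w q : Pt) (f : I), supNorm (q - (b + w)) ≤ R → |G q f| ≤ Γ₀ w) →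
      (∀ (w q : Pt) (f : I) (i : Fin 4), supNorm (q - (b + w)) ≤ R → |G (q + unitVec i) f - G q f| ≤ Γ₁ w) →
      (∀ (w a : Pt), IsStep a → |W (w - a) - W w| ≤ W₁ w) →
      Summable (fun w => |W w| * (Φ₀ w * Γ₁ w)) → Summable (fun w => |W w| * (Φ₀ w * Γ₀ w)) →
      Summable (fun w => W₁ w * (Φ₀ w * Γ₀ w)) →
      Summable (fun w => W w * vtx (b + w) L F G) ∧
        |∑' w, W w * vtx (b + w) L F G| ≤ K * ∑' w, (|W w| * (Φ₀ w * Γ₁ w) + W₁ w * (Φ₀ w * Γ₀ w)) := by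
  obtain ⟨Ts, hTs, hev⟩ := exists_vterms_of_graded h
  obtain ⟨Ds, Bs, hDs, hBs, -, -, -, hnf⟩ := colGood_of_terms Ts hTs
  -- weights and reaches
  let κ : VTerm I → ℝ := fun t => |t.c| * (∑ g, ∑ f, |t.m g f|) * 2 ^ t.len
  let ρ : VTerm I → ℕ := fun t => supNorm t.x + 2 * t.sF.length + supNorm t.y + 2 * t.sG.length
  have hκ0 : ∀ t, 0 ≤ κ t := fun t => by positivity
  refine ⟨(Ds.map κ).sum + (Bs.map fun p => κ p.2).sum, (Ds.map ρ).sum + (Bs.map fun p => ρ p.2).sum,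
    add_nonneg (list_sum_nonneg Ds fun t _ => hκ0 t) (list_sum_nonneg Bs fun p _ => hκ0 p.2), ?_⟩
  intro b F G W Φ₀ Γ₀ Γ₁ W₁ hΦ₀ hΓ₀ hΓ₁ hF₀ hG₀ hG₁ hW₁ hS₁ hS₀ hS₂
  set R : ℕ := (Ds.map ρ).sum + (Bs.map fun p => ρ p.2).sum with hR
  set SΓ : ℝ := ∑' w, (|W w| * (Φ₀ w * Γ₁ w) + W₁ w * (Φ₀ w * Γ₀ w)) with hSΓ
  have hW₁0 : ∀ w, 0 ≤ W₁ w := fun w => (abs_nonneg _).trans (hW₁ w (unitVec 0) ⟨0, Or.inl rfl⟩)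
  have hsum1 : ∑' w, |W w| * (Φ₀ w * Γ₁ w) ≤ SΓ := by
    rw [hSΓ, hS₁.tsum_add hS₂]
    exact le_add_of_nonneg_right (tsum_nonneg fun w => mul_nonneg (hW₁0 w) (mul_nonneg (hΦ₀ w) (hΓ₀ w)))
  have hsum2 : ∑' w, W₁ w * (Φ₀ w * Γ₀ w) ≤ SΓ := by
    rw [hSΓ, hS₁.tsum_add hS₂]
    exact le_add_of_nonneg_left (tsum_nonneg fun w => mul_nonneg (abs_nonneg _) (mul_nonneg (hΦ₀ w) (hΓ₁ w)))
  have hRD : ∀ t ∈ Ds, ρ t ≤ R := fun t ht => (list_le_sum_nat Ds ρ ht).trans (Nat.le_add_right _ _)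
  have hRB : ∀ p ∈ Bs, ρ p.2 ≤ R := fun p hp => (list_le_sum_nat Bs (fun p => ρ p.2) hp).trans (Nat.le_add_left _ _)
  -- direct terms: `Φ₀Γ₁`
  have hdirect : ∀ t ∈ Ds, Summable (fun w => W w * t.eval (b + w) F G) ∧ |∑' w, W w * t.eval (b + w) F G| ≤ κ t * SΓ := by
    intro t ht
    obtain ⟨hne, hsF, hsG⟩ := hDs t ht
    have hpt : ∀ w, |W w * t.eval (b + w) F G| ≤ κ t * (|W w| * (Φ₀ w * Γ₁ w)) := fun w => by
      rw [abs_mul]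
      have h := abs_eval_le_colStep (b + w) R t hne hsF hsG (by have := hRD t ht; simp only [ρ] at this; omega)
        (by have := hRD t ht; simp only [ρ] at this; omega) (hΦ₀ w) (hΓ₁ w) (hF₀ w) (hG₁ w)
      calc |W w| * |t.eval (b + w) F G| ≤ |W w| * (κ t * (Φ₀ w * Γ₁ w)) := mul_le_mul_of_nonneg_left h (abs_nonneg _)
        _ = κ t * (|W w| * (Φ₀ w * Γ₁ w)) := by ring
    obtain ⟨hs, hb⟩ := summable_and_abs_tsum_le_of_le hS₁ hpt
    exact ⟨hs, hb.trans (mul_le_mul_of_nonneg_left hsum1 (hκ0 t))⟩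
  -- by-parts terms: `W₁·Φ₀Γ₀` after the shift
  have hparts : ∀ p ∈ Bs, Summable (fun w => W w * (p.2.eval (b + w + p.1) F G - p.2.eval (b + w) F G)) ∧
      |∑' w, W w * (p.2.eval (b + w + p.1) F G - p.2.eval (b + w) F G)| ≤ κ p.2 * SΓ := by
    intro p hp
    obtain ⟨ha, hsF, hsG⟩ := hBs p hp
    set E : Pt → ℝ := fun w => p.2.eval (b + w) F G with hE
    have hEb : ∀ w, |E w| ≤ κ p.2 * (Φ₀ w * Γ₀ w) := fun w =>
      abs_eval_le_sup (b + w) R p.2 hsF hsG (by have := hRB p hp; simp only [ρ] at this; omega)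
        (by have := hRB p hp; simp only [ρ] at this; omega) (hΦ₀ w) (hF₀ w) (hG₀ w)
    have eE : ∀ w, p.2.eval (b + w + p.1) F G = E (w + p.1) := fun w => by rw [hE]; simp only [add_assoc]
    -- summability of `W·E` and of `W·E(·+a)`
    have h2 : Summable fun w => W w * E w := (summable_and_abs_tsum_le_of_le hS₀ (fun w => by
      rw [abs_mul]
      calc |W w| * |E w| ≤ |W w| * (κ p.2 * (Φ₀ w * Γ₀ w)) := mul_le_mul_of_nonneg_left (hEb w) (abs_nonneg _)
        _ = κ p.2 * (|W w| * (Φ₀ w * Γ₀ w)) := by ring)).1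
    have hWs : ∀ w, |W w| ≤ |W (w + p.1)| + W₁ (w + p.1) := fun w => by
      have h := hW₁ (w + p.1) p.1 ha
      rw [add_sub_cancel_right] at h
      have := abs_sub_abs_le_abs_sub (W w) (W (w + p.1))
      linarith
    have h1 : Summable fun w => W w * E (w + p.1) := by
      have hg : Summable fun w => (|W (w + p.1)| * (Φ₀ (w + p.1) * Γ₀ (w + p.1)) + W₁ (w + p.1) * (Φ₀ (w + p.1) * Γ₀ (w + p.1))) :=
        (summable_shift hS₀ p.1).add (summable_shift hS₂ p.1)
      refine (summable_and_abs_tsum_le_of_le (c := κ p.2) hg fun w => ?_).1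
      rw [abs_mul]
      calc |W w| * |E (w + p.1)| ≤ (|W (w + p.1)| + W₁ (w + p.1)) * (κ p.2 * (Φ₀ (w + p.1) * Γ₀ (w + p.1))) :=
            mul_le_mul (hWs w) (hEb _) (abs_nonneg _) (add_nonneg (abs_nonneg _) (hW₁0 _))
        _ = _ := by ring
    obtain ⟨hs, he⟩ := tsum_shift_sub W E p.1 h1 h2
    refine ⟨hs.congr fun w => by rw [eE], ?_⟩
    rw [show (fun w => W w * (p.2.eval (b + w + p.1) F G - p.2.eval (b + w) F G)) = fun w => W w * (E (w + p.1) - E w) from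
      funext fun w => by rw [eE], he]
    have hpt : ∀ w, |(W (w - p.1) - W w) * E w| ≤ κ p.2 * (W₁ w * (Φ₀ w * Γ₀ w)) := fun w => by
      rw [abs_mul]
      calc |W (w - p.1) - W w| * |E w| ≤ W₁ w * (κ p.2 * (Φ₀ w * Γ₀ w)) := mul_le_mul (hW₁ w p.1 ha) (hEb w) (abs_nonneg _) (hW₁0 w)
        _ = _ := by ring
    exact (summable_and_abs_tsum_le_of_le hS₂ hpt).2.trans (mul_le_mul_of_nonneg_left hsum2 (hκ0 p.2))
  -- assembly
  obtain ⟨hsD, hbD⟩ := abs_tsum_list_sum_le Ds (fun t w => W w * t.eval (b + w) F G) κ SΓ hdirect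
  obtain ⟨hsB, hbB⟩ := abs_tsum_list_sum_le Bs (fun p w => W w * (p.2.eval (b + w + p.1) F G - p.2.eval (b + w) F G)) (fun p => κ p.2) SΓ hparts
  have e : ∀ w, W w * vtx (b + w) L F G = (Ds.map fun t => W w * t.eval (b + w) F G).sum
      + (Bs.map fun p => W w * (p.2.eval (b + w + p.1) F G - p.2.eval (b + w) F G)).sum := fun w => by
    rw [hev (b + w) F G, hnf (b + w) F G, mul_add, mul_list_sum, mul_list_sum]
  simp_rw [e]
  refine ⟨hsD.add hsB, ?_⟩
  rw [hsD.tsum_add hsB]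
  calc |∑' w, (Ds.map fun t => W w * t.eval (b + w) F G).sum + ∑' w, (Bs.map fun p => W w * (p.2.eval (b + w + p.1) F G - p.2.eval (b + w) F G)).sum|
      ≤ (Ds.map κ).sum * SΓ + (Bs.map fun p => κ p.2).sum * SΓ := (abs_add_le _ _).trans (add_le_add hbD hbB)
    _ = ((Ds.map κ).sum + (Bs.map fun p => κ p.2).sum) * SΓ := by ring

/-- [folklore] **THE TRANSPOSED LIST SWAPS THE TWO ENDS**: `vtx z (trStn L) F G = vtx z L G F`. -/
theorem vtx_trStn (z : Pt) (L : Stn I) (F G : Pt → I → ℝ) : vtx z (trStn L) F G = vtx z L G F := by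
  induction L with
  | nil => rfl
  | cons p L ih =>
    have e1 : trStn (p :: L) = ⟨p.y, p.x, p.m.transpose⟩ :: trStn L := rfl
    rw [e1, vtx_cons, vtx_cons, ih, sum_comm]
    congr 1
    refine sum_congr rfl fun f _ => sum_congr rfl fun g _ => ?_
    dsimp only
    rw [Matrix.transpose_apply]; ring

/-- [folklore] **THE SUMMED FRAME OF A LIST OF GRADING 1, ROW END GOOD** (the transpose of `exists_tsum_bound_colGood`): values `|G| ≤ Γ₀(w)` of the
BAD column end; values `|F| ≤ Φ₀(w)` and forward unit differences `|∇F| ≤ Φ₁(w)` of the GOOD row end: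
`|Σ'_w W(w)·vtx (b+w) L F G| ≤ K·Σ'_w (|W(w)|·Φ₁(w)Γ₀(w) + W₁(w)·Φ₀(w)Γ₀(w))`. -/
theorem exists_tsum_bound_rowGood {L : Stn I} (h : Graded 1 L) :
    ∃ (K : ℝ) (R : ℕ), 0 ≤ K ∧ ∀ (b : Pt) (F G : Pt → I → ℝ) (W Φ₀ Φ₁ Γ₀ W₁ : Pt → ℝ),
      (∀ w, 0 ≤ Φ₀ w) → (∀ w, 0 ≤ Φ₁ w) → (∀ w, 0 ≤ Γ₀ w) →
      (∀ (w q : Pt) (g : I), supNorm (q - (b + w)) ≤ R → |F q g| ≤ Φ₀ w) →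
      (∀ (w q : Pt) (g : I) (i : Fin 4), supNorm (q - (b + w)) ≤ R → |F (q + unitVec i) g - F q g| ≤ Φ₁ w) →
      (∀ (w q : Pt) (f : I), supNorm (q - (b + w)) ≤ R → |G q f| ≤ Γ₀ w) →
      (∀ (w a : Pt), IsStep a → |W (w - a) - W w| ≤ W₁ w) →
      Summable (fun w => |W w| * (Γ₀ w * Φ₁ w)) → Summable (fun w => |W w| * (Γ₀ w * Φ₀ w)) →
      Summable (fun w => W₁ w * (Γ₀ w * Φ₀ w)) →
      Summable (fun w => W w * vtx (b + w) L F G) ∧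
        |∑' w, W w * vtx (b + w) L F G| ≤ K * ∑' w, (|W w| * (Γ₀ w * Φ₁ w) + W₁ w * (Γ₀ w * Φ₀ w)) := by
  obtain ⟨K, R, hK, hb⟩ := exists_tsum_bound_colGood (graded_trStn h)
  refine ⟨K, R, hK, fun b F G W Φ₀ Φ₁ Γ₀ W₁ hΦ₀ hΦ₁ hΓ₀ hF₀ hF₁ hG₀ hW₁ hS₁ hS₀ hS₂ => ?_⟩
  have h' := hb b G F W Γ₀ Φ₀ Φ₁ W₁ hΓ₀ hΦ₀ hΦ₁ hG₀ hF₀ hF₁ hW₁ hS₁ hS₀ hS₂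
  simp_rw [vtx_trStn] at h'
  exact h'

end Sums

/-! ## §5 The instances: the transverse Wilson sector `SbT` against a rank-one partner, summed over the (1.22) variable -/

section SbTInstance

/-- [folklore] **THE SUMMED FRAME OF THE `SbT` PIECES, COLUMN END GOOD.**  There are `K ≥ 0` and a window radius `R` (absolute: they depend only on the
four lists `vec₀ κ ++ rem₀ κ`) such that for every direction `κ`, base point `b`, legs `A`, `B`, rank-one partner `φ ⊗ ψ` (row end `ψA` termwise summable),
weight `W` with step modulus `W₁`, and window majorants around `b + w` — values of the BAD row end `|ψA| ≤ Φ₀(w)`, values ∕ forward unit differences of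
the GOOD column end `|Bφ| ≤ Γ₀(w)`, `|∇(Bφ)| ≤ Γ₁(w)` — with `|W|Φ₀Γ₁`, `|W|Φ₀Γ₀`, `W₁Φ₀Γ₀` summable:
`|Σ'_w W(w)·biBubble A (SbT κ (b+w)) B (φ ⊗ ψ)| ≤ K·Σ'_w (|W(w)|·Φ₀(w)Γ₁(w) + W₁(w)·Φ₀(w)Γ₀(w))`. -/
theorem exists_SbT_outer_tsum_bound_colGood :
    ∃ (K : ℝ) (R : ℕ), 0 ≤ K ∧ ∀ (κ : Fin 4) (b : Pt) (A B : MKer 4 (Fin 4)) (φ ψ : Pt → Fin 4 → ℝ),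
      (∀ (s : Pt) (g : Fin 4), Summable fun x : Pt => ∑ a, ψ x a * A x s a g) →
      ∀ (W Φ₀ Γ₀ Γ₁ W₁ : Pt → ℝ), (∀ w, 0 ≤ Φ₀ w) → (∀ w, 0 ≤ Γ₀ w) → (∀ w, 0 ≤ Γ₁ w) →
      (∀ (w q : Pt) (g : Fin 4), supNorm (q - (b + w)) ≤ R → |applyKT ψ A q g| ≤ Φ₀ w) →
      (∀ (w q : Pt) (f : Fin 4), supNorm (q - (b + w)) ≤ R → |applyK B φ q f| ≤ Γ₀ w) →
      (∀ (w q : Pt) (f : Fin 4) (i : Fin 4), supNorm (q - (b + w)) ≤ R → |applyK B φ (q + unitVec i) f - applyK B φ q f| ≤ Γ₁ w) →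
      (∀ (w a : Pt), IsStep a → |W (w - a) - W w| ≤ W₁ w) →
      Summable (fun w => |W w| * (Φ₀ w * Γ₁ w)) → Summable (fun w => |W w| * (Φ₀ w * Γ₀ w)) →
      Summable (fun w => W₁ w * (Φ₀ w * Γ₀ w)) →
      Summable (fun w => W w * biBubble A (SbT κ (b + w)) B (outer φ ψ)) ∧
        |∑' w, W w * biBubble A (SbT κ (b + w)) B (outer φ ψ)| ≤ K * ∑' w, (|W w| * (Φ₀ w * Γ₁ w) + W₁ w * (Φ₀ w * Γ₀ w)) := by
  have h := fun κ : Fin 4 => exists_tsum_bound_colGood (I := Fin 4) (graded_SbT_list κ)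
  choose K R hK hb using h
  refine ⟨∑ κ, K κ, Finset.univ.sup R, sum_nonneg fun κ _ => hK κ,
    fun κ b A B φ ψ hψA W Φ₀ Γ₀ Γ₁ W₁ hΦ₀ hΓ₀ hΓ₁ hF₀ hG₀ hG₁ hW₁ hS₁ hS₀ hS₂ => ?_⟩
  have hRκ : R κ ≤ Finset.univ.sup R := Finset.le_sup (mem_univ κ)
  have e : ∀ w, biBubble A (SbT κ (b + w)) B (outer φ ψ) = vtx (b + w) (reixStn ιU (CrossERestLists.vec₀ κ ++ CrossERestLists.rem₀ κ))
      (applyKT ψ A) (applyK B φ) := fun w => by rw [SbT_eq_realK, biBubble_realK_outer A B (b + w) _ φ ψ hψA]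
  simp_rw [e]
  obtain ⟨hs, hbd⟩ := hb κ b (applyKT ψ A) (applyK B φ) W Φ₀ Γ₀ Γ₁ W₁ hΦ₀ hΓ₀ hΓ₁ (fun w q g hq => hF₀ w q g (hq.trans hRκ))
    (fun w q f hq => hG₀ w q f (hq.trans hRκ)) (fun w q f i hq => hG₁ w q f i (hq.trans hRκ)) hW₁ hS₁ hS₀ hS₂
  refine ⟨hs, hbd.trans (mul_le_mul_of_nonneg_right (single_le_sum (f := K) (fun κ _ => hK κ) (mem_univ κ)) ?_)⟩
  have hW₁0 : ∀ w, 0 ≤ W₁ w := fun w => (abs_nonneg _).trans (hW₁ w (unitVec 0) ⟨0, Or.inl rfl⟩)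
  exact tsum_nonneg fun w => add_nonneg (mul_nonneg (abs_nonneg _) (mul_nonneg (hΦ₀ w) (hΓ₁ w))) (mul_nonneg (hW₁0 w) (mul_nonneg (hΦ₀ w) (hΓ₀ w)))

/-- [folklore] **THE SUMMED FRAME OF THE `SbT` PIECES, ROW END GOOD** (mirror): values of the BAD column end `|Bφ| ≤ Γ₀(w)`; values ∕ forward unit
differences of the GOOD row end `|ψA| ≤ Φ₀(w)`, `|∇(ψA)| ≤ Φ₁(w)`:
`|Σ'_w W(w)·biBubble A (SbT κ (b+w)) B (φ ⊗ ψ)| ≤ K·Σ'_w (|W(w)|·Γ₀(w)Φ₁(w) + W₁(w)·Γ₀(w)Φ₀(w))`. -/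
theorem exists_SbT_outer_tsum_bound_rowGood :
    ∃ (K : ℝ) (R : ℕ), 0 ≤ K ∧ ∀ (κ : Fin 4) (b : Pt) (A B : MKer 4 (Fin 4)) (φ ψ : Pt → Fin 4 → ℝ),
      (∀ (s : Pt) (g : Fin 4), Summable fun x : Pt => ∑ a, ψ x a * A x s a g) →
      ∀ (W Φ₀ Φ₁ Γ₀ W₁ : Pt → ℝ), (∀ w, 0 ≤ Φ₀ w) → (∀ w, 0 ≤ Φ₁ w) → (∀ w, 0 ≤ Γ₀ w) →
      (∀ (w q : Pt) (g : Fin 4), supNorm (q - (b + w)) ≤ R → |applyKT ψ A q g| ≤ Φ₀ w) →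
      (∀ (w q : Pt) (g : Fin 4) (i : Fin 4), supNorm (q - (b + w)) ≤ R → |applyKT ψ A (q + unitVec i) g - applyKT ψ A q g| ≤ Φ₁ w) →
      (∀ (w q : Pt) (f : Fin 4), supNorm (q - (b + w)) ≤ R → |applyK B φ q f| ≤ Γ₀ w) →
      (∀ (w a : Pt), IsStep a → |W (w - a) - W w| ≤ W₁ w) →
      Summable (fun w => |W w| * (Γ₀ w * Φ₁ w)) → Summable (fun w => |W w| * (Γ₀ w * Φ₀ w)) →
      Summable (fun w => W₁ w * (Γ₀ w * Φ₀ w)) →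
      Summable (fun w => W w * biBubble A (SbT κ (b + w)) B (outer φ ψ)) ∧
        |∑' w, W w * biBubble A (SbT κ (b + w)) B (outer φ ψ)| ≤ K * ∑' w, (|W w| * (Γ₀ w * Φ₁ w) + W₁ w * (Γ₀ w * Φ₀ w)) := by
  have h := fun κ : Fin 4 => exists_tsum_bound_rowGood (I := Fin 4) (graded_SbT_list κ)
  choose K R hK hb using h
  refine ⟨∑ κ, K κ, Finset.univ.sup R, sum_nonneg fun κ _ => hK κ,
    fun κ b A B φ ψ hψA W Φ₀ Φ₁ Γ₀ W₁ hΦ₀ hΦ₁ hΓ₀ hF₀ hF₁ hG₀ hW₁ hS₁ hS₀ hS₂ => ?_⟩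
  have hRκ : R κ ≤ Finset.univ.sup R := Finset.le_sup (mem_univ κ)
  have e : ∀ w, biBubble A (SbT κ (b + w)) B (outer φ ψ) = vtx (b + w) (reixStn ιU (CrossERestLists.vec₀ κ ++ CrossERestLists.rem₀ κ))
      (applyKT ψ A) (applyK B φ) := fun w => by rw [SbT_eq_realK, biBubble_realK_outer A B (b + w) _ φ ψ hψA]
  simp_rw [e]
  obtain ⟨hs, hbd⟩ := hb κ b (applyKT ψ A) (applyK B φ) W Φ₀ Φ₁ Γ₀ W₁ hΦ₀ hΦ₁ hΓ₀ (fun w q g hq => hF₀ w q g (hq.trans hRκ))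
    (fun w q g i hq => hF₁ w q g i (hq.trans hRκ)) (fun w q f hq => hG₀ w q f (hq.trans hRκ)) hW₁ hS₁ hS₀ hS₂
  refine ⟨hs, hbd.trans (mul_le_mul_of_nonneg_right (single_le_sum (f := K) (fun κ _ => hK κ) (mem_univ κ)) ?_)⟩
  have hW₁0 : ∀ w, 0 ≤ W₁ w := fun w => (abs_nonneg _).trans (hW₁ w (unitVec 0) ⟨0, Or.inl rfl⟩)
  exact tsum_nonneg fun w => add_nonneg (mul_nonneg (abs_nonneg _) (mul_nonneg (hΓ₀ w) (hΦ₁ w))) (mul_nonneg (hW₁0 w) (mul_nonneg (hΓ₀ w) (hΦ₀ w)))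

end SbTInstance

end Summit.QuantumFields.BalabanUV.Beta.D1BFx.LocalVertexByParts

end
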